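import Summits.Ventures.Crystal3D.Theorems.StickyWulffConstantPolycrystalWulffBoundAggSums

/-!
# `PolycrystalWulffBound`, line `PolyDensity`: the recolour / delete rows of `AggCert27_8` in named variables (part A)

Route `StickyWulffConstant` of the venture `Summits/Ventures/Crystal3D`, crux `PolycrystalWulffBound`
(item `stmt-Ventures-19482`), second prover lane (poly-p2, gen 7).  Pure algebra over a finite class type `β`
with three distinguished classes `a, b, c` and remainder `T = univ \\ {a,b,c}` (non-empty): from the GENERIC
class-level recolouring and deletion inequalities (the shape delivered by `rec_row_classes` /
`del_row_classes` — hypotheses `hrec`, `hdel` on abstract `F Y Acl v`, energy `En`, volume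
`V = Σ v`) and the walls row `Σ F + Σ_{i≠j} Acl/2 ≤ En`, derive the energy row and the 35 recolour / delete
rows of `def AggCert27_8` in named variables, un-normalised, with the rounded coefficients
`√5 − √3 ≤ 0.50402`, `√5 − 1 ≤ 1.23607`.  This file: part A = energy row and the moves of at most two explicit classes.  Generated mechanically from the text of
`def AggCert27_8`; dictionary lemmas in `…AggSums` / `…AggCuts`.
WHAT THIS IS NOT: the static rows (`…AggNamedStaticA/B`), the normalisation, the texture; F-C1 not moved.
-/

namespace Summit.Ventures.Crystal3D.Theorems

open Finset

set_option maxHeartbeats 1000000 in  -- 18 rows, one short linear step each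
/-- Recolour/delete rows of `AggCert27_8` in named variables, part A = energy row and the moves of at most two explicit classes (un-normalised; see the module docstring). -/
theorem aggNamed_movesA {β : Type} [Fintype β] [DecidableEq β] (F Y : β → ℝ) (Acl : β → β → ℝ) (v : β → ℝ) (V En : ℝ)
    {a b c : β} (hab : a ≠ b) (hbc : b ≠ c) (hac : a ≠ c)
    (hT : (Finset.univ \ ({a, b, c} : Finset β)).Nonempty)
    (hV : V = v a + v b + v c + ∑ r ∈ Finset.univ \ {a, b, c}, v r)
    (hY_nn : ∀ i, 0 ≤ Y i) (hAcl_nn : ∀ i j, i ≠ j → 0 ≤ Acl i j) (hAcl_symm : ∀ i j, Acl i j = Acl j i)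
    (hE : (∑ i, F i) + (∑ i, ∑ j, (if i ≠ j then Acl i j / 2 else 0)) ≤ En)
    (hrec : ∀ (𝒮 : Finset β) (l : β), l ∉ 𝒮 → 𝒮.Nonempty →
      6 * (2 : ℝ) ^ ((1 : ℝ) / 3) * (Real.sqrt 2 * V) ^ ((2 : ℝ) / 3) ≤ En + (Real.sqrt 5 - Real.sqrt 3) * (∑ i ∈ 𝒮, Y i)
        - (∑ i, ∑ j, (if ((i ∈ insert l 𝒮) ∧ (j ∈ insert l 𝒮)) ∧ i ≠ j then Acl i j / 2 else 0)))
    (hdel : ∀ (𝒮 : Finset β), 𝒮.Nonempty → (∃ l, l ∉ 𝒮) →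
      6 * (2 : ℝ) ^ ((1 : ℝ) / 3) * (Real.sqrt 2 * (V - ∑ i ∈ 𝒮, v i)) ^ ((2 : ℝ) / 3) ≤ En - (∑ i ∈ 𝒮, F i)
        + (Real.sqrt 5 - 1) * (∑ i ∈ Finset.univ \ 𝒮, ∑ j ∈ 𝒮, Acl i j)
        - (∑ i, ∑ j, (if ((i ∈ 𝒮) ∧ (j ∈ 𝒮)) ∧ i ≠ j then Acl i j / 2 else 0))) :
    (F a + F b + F c + (∑ r ∈ Finset.univ \ {a, b, c}, F r) + Acl a b + Acl a c + (∑ r ∈ Finset.univ \ {a, b, c}, Acl a r) + Acl b c + (∑ r ∈ Finset.univ \ {a, b, c}, Acl b r) + (∑ r ∈ Finset.univ \ {a, b, c}, Acl c r) + ((∑ i ∈ Finset.univ \ {a, b, c}, ∑ j ∈ (Finset.univ \ {a, b, c}) \ {i}, Acl i j) / 2) ≤ En) ∧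
    (6 * (2 : ℝ) ^ ((1 : ℝ) / 3) * (Real.sqrt 2 * V) ^ ((2 : ℝ) / 3) ≤ En + ((25201 : ℝ) / 50000) * (Y a) - (Acl a b)) ∧
    (6 * (2 : ℝ) ^ ((1 : ℝ) / 3) * (Real.sqrt 2 * V) ^ ((2 : ℝ) / 3) ≤ En + ((25201 : ℝ) / 50000) * (Y a) - (Acl a c)) ∧
    (6 * (2 : ℝ) ^ ((1 : ℝ) / 3) * (Real.sqrt 2 * (v b + v c + (∑ r ∈ Finset.univ \ {a, b, c}, v r))) ^ ((2 : ℝ) / 3) ≤ En - (F a) + ((123607 : ℝ) / 100000) * (Acl a b + Acl a c + (∑ r ∈ Finset.univ \ {a, b, c}, Acl a r))) ∧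
    (6 * (2 : ℝ) ^ ((1 : ℝ) / 3) * (Real.sqrt 2 * V) ^ ((2 : ℝ) / 3) ≤ En + ((25201 : ℝ) / 50000) * (Y b) - (Acl a b)) ∧
    (6 * (2 : ℝ) ^ ((1 : ℝ) / 3) * (Real.sqrt 2 * V) ^ ((2 : ℝ) / 3) ≤ En + ((25201 : ℝ) / 50000) * (Y b) - (Acl b c)) ∧
    (6 * (2 : ℝ) ^ ((1 : ℝ) / 3) * (Real.sqrt 2 * (v a + v c + (∑ r ∈ Finset.univ \ {a, b, c}, v r))) ^ ((2 : ℝ) / 3) ≤ En - (F b) + ((123607 : ℝ) / 100000) * (Acl a b + Acl b c + (∑ r ∈ Finset.univ \ {a, b, c}, Acl b r))) ∧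
    (6 * (2 : ℝ) ^ ((1 : ℝ) / 3) * (Real.sqrt 2 * V) ^ ((2 : ℝ) / 3) ≤ En + ((25201 : ℝ) / 50000) * (Y c) - (Acl a c)) ∧
    (6 * (2 : ℝ) ^ ((1 : ℝ) / 3) * (Real.sqrt 2 * V) ^ ((2 : ℝ) / 3) ≤ En + ((25201 : ℝ) / 50000) * (Y c) - (Acl b c)) ∧
    (6 * (2 : ℝ) ^ ((1 : ℝ) / 3) * (Real.sqrt 2 * (v a + v b + (∑ r ∈ Finset.univ \ {a, b, c}, v r))) ^ ((2 : ℝ) / 3) ≤ En - (F c) + ((123607 : ℝ) / 100000) * (Acl a c + Acl b c + (∑ r ∈ Finset.univ \ {a, b, c}, Acl c r))) ∧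
    (6 * (2 : ℝ) ^ ((1 : ℝ) / 3) * (Real.sqrt 2 * V) ^ ((2 : ℝ) / 3) ≤ En + ((25201 : ℝ) / 50000) * ((∑ r ∈ Finset.univ \ {a, b, c}, Y r)) - ((∑ r ∈ Finset.univ \ {a, b, c}, Acl a r) + ((∑ i ∈ Finset.univ \ {a, b, c}, ∑ j ∈ (Finset.univ \ {a, b, c}) \ {i}, Acl i j) / 2))) ∧
    (6 * (2 : ℝ) ^ ((1 : ℝ) / 3) * (Real.sqrt 2 * V) ^ ((2 : ℝ) / 3) ≤ En + ((25201 : ℝ) / 50000) * ((∑ r ∈ Finset.univ \ {a, b, c}, Y r)) - ((∑ r ∈ Finset.univ \ {a, b, c}, Acl b r) + ((∑ i ∈ Finset.univ \ {a, b, c}, ∑ j ∈ (Finset.univ \ {a, b, c}) \ {i}, Acl i j) / 2))) ∧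
    (6 * (2 : ℝ) ^ ((1 : ℝ) / 3) * (Real.sqrt 2 * V) ^ ((2 : ℝ) / 3) ≤ En + ((25201 : ℝ) / 50000) * ((∑ r ∈ Finset.univ \ {a, b, c}, Y r)) - ((∑ r ∈ Finset.univ \ {a, b, c}, Acl c r) + ((∑ i ∈ Finset.univ \ {a, b, c}, ∑ j ∈ (Finset.univ \ {a, b, c}) \ {i}, Acl i j) / 2))) ∧
    (6 * (2 : ℝ) ^ ((1 : ℝ) / 3) * (Real.sqrt 2 * (v a + v b + v c)) ^ ((2 : ℝ) / 3) ≤ En - ((∑ r ∈ Finset.univ \ {a, b, c}, F r)) + ((123607 : ℝ) / 100000) * ((∑ r ∈ Finset.univ \ {a, b, c}, Acl a r) + (∑ r ∈ Finset.univ \ {a, b, c}, Acl b r) + (∑ r ∈ Finset.univ \ {a, b, c}, Acl c r)) - (((∑ i ∈ Finset.univ \ {a, b, c}, ∑ j ∈ (Finset.univ \ {a, b, c}) \ {i}, Acl i j) / 2))) ∧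
    (6 * (2 : ℝ) ^ ((1 : ℝ) / 3) * (Real.sqrt 2 * V) ^ ((2 : ℝ) / 3) ≤ En + ((25201 : ℝ) / 50000) * (Y a + Y b) - (Acl a b + Acl a c + Acl b c)) ∧
    (6 * (2 : ℝ) ^ ((1 : ℝ) / 3) * (Real.sqrt 2 * (v c + (∑ r ∈ Finset.univ \ {a, b, c}, v r))) ^ ((2 : ℝ) / 3) ≤ En - (F a + F b) + ((123607 : ℝ) / 100000) * (Acl a c + (∑ r ∈ Finset.univ \ {a, b, c}, Acl a r) + Acl b c + (∑ r ∈ Finset.univ \ {a, b, c}, Acl b r)) - (Acl a b)) ∧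
    (6 * (2 : ℝ) ^ ((1 : ℝ) / 3) * (Real.sqrt 2 * V) ^ ((2 : ℝ) / 3) ≤ En + ((25201 : ℝ) / 50000) * (Y a + Y c) - (Acl a b + Acl a c + Acl b c)) ∧
    (6 * (2 : ℝ) ^ ((1 : ℝ) / 3) * (Real.sqrt 2 * (v b + (∑ r ∈ Finset.univ \ {a, b, c}, v r))) ^ ((2 : ℝ) / 3) ≤ En - (F a + F c) + ((123607 : ℝ) / 100000) * (Acl a b + (∑ r ∈ Finset.univ \ {a, b, c}, Acl a r) + Acl b c + (∑ r ∈ Finset.univ \ {a, b, c}, Acl c r)) - (Acl a c)) := by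
  have h17 : (34641 : ℝ) / 20000 ≤ Real.sqrt 3 := by
    rw [show ((34641 : ℝ) / 20000) = Real.sqrt (((34641 : ℝ) / 20000) ^ 2) by rw [Real.sqrt_sq (by norm_num)]]
    exact Real.sqrt_le_sqrt (by norm_num)
  have hsq5 : Real.sqrt 5 ≤ (223607 : ℝ) / 100000 := by
    rw [show ((223607 : ℝ) / 100000) = Real.sqrt (((223607 : ℝ) / 100000) ^ 2) by rw [Real.sqrt_sq (by norm_num)]]
    exact Real.sqrt_le_sqrt (by norm_num)
  have ha_disc : Real.sqrt 5 - Real.sqrt 3 ≤ (25201 : ℝ) / 50000 := by linarith only [h17, hsq5]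
  have hd_disc : Real.sqrt 5 - 1 ≤ (123607 : ℝ) / 100000 := by linarith only [hsq5]
  have hba := hAcl_symm b a
  have hca := hAcl_symm c a
  have hcb := hAcl_symm c b
  have hAab : 0 ≤ Acl a b := hAcl_nn a b hab
  have hAac : 0 ≤ Acl a c := hAcl_nn a c hac
  have hAbc : 0 ≤ Acl b c := hAcl_nn b c hbc
  have hTa : 0 ≤ ∑ r ∈ Finset.univ \ {a, b, c}, Acl a r :=
    Finset.sum_nonneg fun r hr => hAcl_nn a r (by rintro rfl; simp at hr)
  have hTb : 0 ≤ ∑ r ∈ Finset.univ \ {a, b, c}, Acl b r :=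
    Finset.sum_nonneg fun r hr => hAcl_nn b r (by rintro rfl; simp at hr)
  have hTc : 0 ≤ ∑ r ∈ Finset.univ \ {a, b, c}, Acl c r :=
    Finset.sum_nonneg fun r hr => hAcl_nn c r (by rintro rfl; simp at hr)
  have hTY : 0 ≤ ∑ r ∈ Finset.univ \ {a, b, c}, Y r := Finset.sum_nonneg fun r _ => hY_nn r
  have hYa := hY_nn a
  have hYb := hY_nn b
  have hYc := hY_nn c
  have haT : a ∉ Finset.univ \ ({a, b, c} : Finset β) := by simp
  have hbT : b ∉ Finset.univ \ ({a, b, c} : Finset β) := by simp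
  have hcT : c ∉ Finset.univ \ ({a, b, c} : Finset β) := by simp
  obtain ⟨r0, hr0⟩ := hT
  have hr0' : r0 ∉ ({a, b, c} : Finset β) := (Finset.mem_sdiff.1 hr0).2
  have r_E : F a + F b + F c + (∑ r ∈ Finset.univ \ {a, b, c}, F r) + Acl a b + Acl a c + (∑ r ∈ Finset.univ \ {a, b, c}, Acl a r) + Acl b c + (∑ r ∈ Finset.univ \ {a, b, c}, Acl b r) + (∑ r ∈ Finset.univ \ {a, b, c}, Acl c r) + ((∑ i ∈ Finset.univ \ {a, b, c}, ∑ j ∈ (Finset.univ \ {a, b, c}) \ {i}, Acl i j) / 2) ≤ En := by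
    have h := hE
    rw [offdiag_sum_univ Acl, offdiag_sum_restrict Acl Finset.univ, sum_univ_split_three hab hbc hac F,
      sum_univ_split_three hab hbc hac (fun i => ∑ j ∈ Finset.univ \ {i}, Acl i j)] at h
    rw [sum_sdiff_single_split hab hbc hac (Acl a), sum_sdiff_single_split_b hab hbc hac (Acl b),
      sum_sdiff_single_split_c hab hbc hac (Acl c), singles_sum_remainder Acl hAcl_symm hab hbc hac] at h
    linarith only [h, hba, hca, hcb]
  have r_rec1_2 : 6 * (2 : ℝ) ^ ((1 : ℝ) / 3) * (Real.sqrt 2 * V) ^ ((2 : ℝ) / 3) ≤ En + ((25201 : ℝ) / 50000) * (Y a) - (Acl a b) := by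
    have h := hrec (({a} : Finset β)) b (by simp [hab.symm]) ⟨a, by simp⟩
    rw [offdiag_sum_insert Acl hAcl_symm (by simp [hab.symm])] at h
    rw [offdiag_sum_singleton Acl a] at h
    simp only [Finset.sum_singleton] at h
    have hw := mul_le_mul_of_nonneg_right ha_disc (hYa)
    linarith only [h, hw, hba, hca, hcb]
  have r_rec1_3 : 6 * (2 : ℝ) ^ ((1 : ℝ) / 3) * (Real.sqrt 2 * V) ^ ((2 : ℝ) / 3) ≤ En + ((25201 : ℝ) / 50000) * (Y a) - (Acl a c) := by
    have h := hrec (({a} : Finset β)) c (by simp [hac.symm]) ⟨a, by simp⟩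
    rw [offdiag_sum_insert Acl hAcl_symm (by simp [hac.symm])] at h
    rw [offdiag_sum_singleton Acl a] at h
    simp only [Finset.sum_singleton] at h
    have hw := mul_le_mul_of_nonneg_right ha_disc (hYa)
    linarith only [h, hw, hba, hca, hcb]
  have r_del1 : 6 * (2 : ℝ) ^ ((1 : ℝ) / 3) * (Real.sqrt 2 * (v b + v c + (∑ r ∈ Finset.univ \ {a, b, c}, v r))) ^ ((2 : ℝ) / 3) ≤ En - (F a) + ((123607 : ℝ) / 100000) * (Acl a b + Acl a c + (∑ r ∈ Finset.univ \ {a, b, c}, Acl a r)) := by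
    have h := hdel (({a} : Finset β)) ⟨a, by simp⟩ ⟨b, (by simp [hab.symm])⟩
    rw [cut_symm Acl hAcl_symm (({a} : Finset β)), cut_single_a Acl hab hbc hac] at h
    rw [offdiag_sum_singleton Acl a] at h
    simp only [Finset.sum_singleton] at h
    rw [show V - v a = v b + v c + (∑ r ∈ Finset.univ \ {a, b, c}, v r) by linarith only [hV]] at h
    have hw := mul_le_mul_of_nonneg_right hd_disc (add_nonneg (add_nonneg hAab hAac) hTa)
    linarith only [h, hw, hba, hca, hcb]
  have r_rec2_1 : 6 * (2 : ℝ) ^ ((1 : ℝ) / 3) * (Real.sqrt 2 * V) ^ ((2 : ℝ) / 3) ≤ En + ((25201 : ℝ) / 50000) * (Y b) - (Acl a b) := by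
    have h := hrec (({b} : Finset β)) a (by simp [hab]) ⟨b, by simp⟩
    rw [offdiag_sum_insert Acl hAcl_symm (by simp [hab])] at h
    rw [offdiag_sum_singleton Acl b] at h
    simp only [Finset.sum_singleton] at h
    have hw := mul_le_mul_of_nonneg_right ha_disc (hYb)
    linarith only [h, hw, hba, hca, hcb]
  have r_rec2_3 : 6 * (2 : ℝ) ^ ((1 : ℝ) / 3) * (Real.sqrt 2 * V) ^ ((2 : ℝ) / 3) ≤ En + ((25201 : ℝ) / 50000) * (Y b) - (Acl b c) := by
    have h := hrec (({b} : Finset β)) c (by simp [hbc.symm]) ⟨b, by simp⟩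
    rw [offdiag_sum_insert Acl hAcl_symm (by simp [hbc.symm])] at h
    rw [offdiag_sum_singleton Acl b] at h
    simp only [Finset.sum_singleton] at h
    have hw := mul_le_mul_of_nonneg_right ha_disc (hYb)
    linarith only [h, hw, hba, hca, hcb]
  have r_del2 : 6 * (2 : ℝ) ^ ((1 : ℝ) / 3) * (Real.sqrt 2 * (v a + v c + (∑ r ∈ Finset.univ \ {a, b, c}, v r))) ^ ((2 : ℝ) / 3) ≤ En - (F b) + ((123607 : ℝ) / 100000) * (Acl a b + Acl b c + (∑ r ∈ Finset.univ \ {a, b, c}, Acl b r)) := by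
    have h := hdel (({b} : Finset β)) ⟨b, by simp⟩ ⟨a, (by simp [hab])⟩
    rw [cut_symm Acl hAcl_symm (({b} : Finset β)), cut_single_b Acl hAcl_symm hab hbc hac] at h
    rw [offdiag_sum_singleton Acl b] at h
    simp only [Finset.sum_singleton] at h
    rw [show V - v b = v a + v c + (∑ r ∈ Finset.univ \ {a, b, c}, v r) by linarith only [hV]] at h
    have hw := mul_le_mul_of_nonneg_right hd_disc (add_nonneg (add_nonneg hAab hAbc) hTb)
    linarith only [h, hw, hba, hca, hcb]
  have r_rec3_1 : 6 * (2 : ℝ) ^ ((1 : ℝ) / 3) * (Real.sqrt 2 * V) ^ ((2 : ℝ) / 3) ≤ En + ((25201 : ℝ) / 50000) * (Y c) - (Acl a c) := by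
    have h := hrec (({c} : Finset β)) a (by simp [hac]) ⟨c, by simp⟩
    rw [offdiag_sum_insert Acl hAcl_symm (by simp [hac])] at h
    rw [offdiag_sum_singleton Acl c] at h
    simp only [Finset.sum_singleton] at h
    have hw := mul_le_mul_of_nonneg_right ha_disc (hYc)
    linarith only [h, hw, hba, hca, hcb]
  have r_rec3_2 : 6 * (2 : ℝ) ^ ((1 : ℝ) / 3) * (Real.sqrt 2 * V) ^ ((2 : ℝ) / 3) ≤ En + ((25201 : ℝ) / 50000) * (Y c) - (Acl b c) := by
    have h := hrec (({c} : Finset β)) b (by simp [hbc]) ⟨c, by simp⟩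
    rw [offdiag_sum_insert Acl hAcl_symm (by simp [hbc])] at h
    rw [offdiag_sum_singleton Acl c] at h
    simp only [Finset.sum_singleton] at h
    have hw := mul_le_mul_of_nonneg_right ha_disc (hYc)
    linarith only [h, hw, hba, hca, hcb]
  have r_del3 : 6 * (2 : ℝ) ^ ((1 : ℝ) / 3) * (Real.sqrt 2 * (v a + v b + (∑ r ∈ Finset.univ \ {a, b, c}, v r))) ^ ((2 : ℝ) / 3) ≤ En - (F c) + ((123607 : ℝ) / 100000) * (Acl a c + Acl b c + (∑ r ∈ Finset.univ \ {a, b, c}, Acl c r)) := by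
    have h := hdel (({c} : Finset β)) ⟨c, by simp⟩ ⟨a, (by simp [hac])⟩
    rw [cut_symm Acl hAcl_symm (({c} : Finset β)), cut_single_c Acl hAcl_symm hab hbc hac] at h
    rw [offdiag_sum_singleton Acl c] at h
    simp only [Finset.sum_singleton] at h
    rw [show V - v c = v a + v b + (∑ r ∈ Finset.univ \ {a, b, c}, v r) by linarith only [hV]] at h
    have hw := mul_le_mul_of_nonneg_right hd_disc (add_nonneg (add_nonneg hAac hAbc) hTc)
    linarith only [h, hw, hba, hca, hcb]
  have r_recR_1 : 6 * (2 : ℝ) ^ ((1 : ℝ) / 3) * (Real.sqrt 2 * V) ^ ((2 : ℝ) / 3) ≤ En + ((25201 : ℝ) / 50000) * ((∑ r ∈ Finset.univ \ {a, b, c}, Y r)) - ((∑ r ∈ Finset.univ \ {a, b, c}, Acl a r) + ((∑ i ∈ Finset.univ \ {a, b, c}, ∑ j ∈ (Finset.univ \ {a, b, c}) \ {i}, Acl i j) / 2)) := by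
    have h := hrec ((Finset.univ \ {a, b, c})) a haT ⟨r0, hr0⟩
    rw [offdiag_sum_insert Acl hAcl_symm haT] at h
    rw [offdiag_sum_restrict Acl (Finset.univ \ {a, b, c})] at h
    have hw := mul_le_mul_of_nonneg_right ha_disc (hTY)
    linarith only [h, hw, hba, hca, hcb]
  have r_recR_2 : 6 * (2 : ℝ) ^ ((1 : ℝ) / 3) * (Real.sqrt 2 * V) ^ ((2 : ℝ) / 3) ≤ En + ((25201 : ℝ) / 50000) * ((∑ r ∈ Finset.univ \ {a, b, c}, Y r)) - ((∑ r ∈ Finset.univ \ {a, b, c}, Acl b r) + ((∑ i ∈ Finset.univ \ {a, b, c}, ∑ j ∈ (Finset.univ \ {a, b, c}) \ {i}, Acl i j) / 2)) := by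
    have h := hrec ((Finset.univ \ {a, b, c})) b hbT ⟨r0, hr0⟩
    rw [offdiag_sum_insert Acl hAcl_symm hbT] at h
    rw [offdiag_sum_restrict Acl (Finset.univ \ {a, b, c})] at h
    have hw := mul_le_mul_of_nonneg_right ha_disc (hTY)
    linarith only [h, hw, hba, hca, hcb]
  have r_recR_3 : 6 * (2 : ℝ) ^ ((1 : ℝ) / 3) * (Real.sqrt 2 * V) ^ ((2 : ℝ) / 3) ≤ En + ((25201 : ℝ) / 50000) * ((∑ r ∈ Finset.univ \ {a, b, c}, Y r)) - ((∑ r ∈ Finset.univ \ {a, b, c}, Acl c r) + ((∑ i ∈ Finset.univ \ {a, b, c}, ∑ j ∈ (Finset.univ \ {a, b, c}) \ {i}, Acl i j) / 2)) := by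
    have h := hrec ((Finset.univ \ {a, b, c})) c hcT ⟨r0, hr0⟩
    rw [offdiag_sum_insert Acl hAcl_symm hcT] at h
    rw [offdiag_sum_restrict Acl (Finset.univ \ {a, b, c})] at h
    have hw := mul_le_mul_of_nonneg_right ha_disc (hTY)
    linarith only [h, hw, hba, hca, hcb]
  have r_delR : 6 * (2 : ℝ) ^ ((1 : ℝ) / 3) * (Real.sqrt 2 * (v a + v b + v c)) ^ ((2 : ℝ) / 3) ≤ En - ((∑ r ∈ Finset.univ \ {a, b, c}, F r)) + ((123607 : ℝ) / 100000) * ((∑ r ∈ Finset.univ \ {a, b, c}, Acl a r) + (∑ r ∈ Finset.univ \ {a, b, c}, Acl b r) + (∑ r ∈ Finset.univ \ {a, b, c}, Acl c r)) - (((∑ i ∈ Finset.univ \ {a, b, c}, ∑ j ∈ (Finset.univ \ {a, b, c}) \ {i}, Acl i j) / 2)) := by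
    have h := hdel ((Finset.univ \ {a, b, c})) ⟨r0, hr0⟩ ⟨a, haT⟩
    rw [cut_symm Acl hAcl_symm ((Finset.univ \ {a, b, c})), cut_remainder Acl hAcl_symm hab hbc hac] at h
    rw [offdiag_sum_restrict Acl (Finset.univ \ {a, b, c})] at h
    rw [show V - ∑ l ∈ Finset.univ \ {a, b, c}, v l = v a + v b + v c by linarith only [hV]] at h
    have hw := mul_le_mul_of_nonneg_right hd_disc (add_nonneg (add_nonneg hTa hTb) hTc)
    linarith only [h, hw, hba, hca, hcb]
  have r_rec12_3 : 6 * (2 : ℝ) ^ ((1 : ℝ) / 3) * (Real.sqrt 2 * V) ^ ((2 : ℝ) / 3) ≤ En + ((25201 : ℝ) / 50000) * (Y a + Y b) - (Acl a b + Acl a c + Acl b c) := by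
    have h := hrec (({a, b} : Finset β)) c (by simp [hac.symm, hbc.symm]) ⟨a, by simp⟩
    rw [offdiag_sum_insert Acl hAcl_symm (by simp [hac.symm, hbc.symm])] at h
    rw [offdiag_sum_insert Acl hAcl_symm (by simp [hab]), offdiag_sum_singleton Acl b] at h
    simp only [Finset.sum_singleton, Finset.sum_pair hab] at h
    have hw := mul_le_mul_of_nonneg_right ha_disc (add_nonneg hYa hYb)
    linarith only [h, hw, hba, hca, hcb]
  have r_del12 : 6 * (2 : ℝ) ^ ((1 : ℝ) / 3) * (Real.sqrt 2 * (v c + (∑ r ∈ Finset.univ \ {a, b, c}, v r))) ^ ((2 : ℝ) / 3) ≤ En - (F a + F b) + ((123607 : ℝ) / 100000) * (Acl a c + (∑ r ∈ Finset.univ \ {a, b, c}, Acl a r) + Acl b c + (∑ r ∈ Finset.univ \ {a, b, c}, Acl b r)) - (Acl a b) := by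
    have h := hdel (({a, b} : Finset β)) ⟨a, by simp⟩ ⟨c, (by simp [hac.symm, hbc.symm])⟩
    rw [cut_symm Acl hAcl_symm (({a, b} : Finset β)), cut_pair_ab Acl hab hbc hac] at h
    rw [offdiag_sum_insert Acl hAcl_symm (by simp [hab]), offdiag_sum_singleton Acl b] at h
    simp only [Finset.sum_singleton, Finset.sum_pair hab] at h
    rw [show V - (v a + v b) = v c + (∑ r ∈ Finset.univ \ {a, b, c}, v r) by linarith only [hV]] at h
    have hw := mul_le_mul_of_nonneg_right hd_disc (add_nonneg (add_nonneg (add_nonneg hAac hTa) hAbc) hTb)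
    linarith only [h, hw, hba, hca, hcb]
  have r_rec13_2 : 6 * (2 : ℝ) ^ ((1 : ℝ) / 3) * (Real.sqrt 2 * V) ^ ((2 : ℝ) / 3) ≤ En + ((25201 : ℝ) / 50000) * (Y a + Y c) - (Acl a b + Acl a c + Acl b c) := by
    have h := hrec (({a, c} : Finset β)) b (by simp [hab.symm, hbc]) ⟨a, by simp⟩
    rw [offdiag_sum_insert Acl hAcl_symm (by simp [hab.symm, hbc])] at h
    rw [offdiag_sum_insert Acl hAcl_symm (by simp [hac]), offdiag_sum_singleton Acl c] at h
    simp only [Finset.sum_singleton, Finset.sum_pair hac] at h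
    have hw := mul_le_mul_of_nonneg_right ha_disc (add_nonneg hYa hYc)
    linarith only [h, hw, hba, hca, hcb]
  have r_del13 : 6 * (2 : ℝ) ^ ((1 : ℝ) / 3) * (Real.sqrt 2 * (v b + (∑ r ∈ Finset.univ \ {a, b, c}, v r))) ^ ((2 : ℝ) / 3) ≤ En - (F a + F c) + ((123607 : ℝ) / 100000) * (Acl a b + (∑ r ∈ Finset.univ \ {a, b, c}, Acl a r) + Acl b c + (∑ r ∈ Finset.univ \ {a, b, c}, Acl c r)) - (Acl a c) := by
    have h := hdel (({a, c} : Finset β)) ⟨a, by simp⟩ ⟨b, (by simp [hab.symm, hbc])⟩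
    rw [cut_symm Acl hAcl_symm (({a, c} : Finset β)), cut_pair_ac Acl hAcl_symm hab hbc hac] at h
    rw [offdiag_sum_insert Acl hAcl_symm (by simp [hac]), offdiag_sum_singleton Acl c] at h
    simp only [Finset.sum_singleton, Finset.sum_pair hac] at h
    rw [show V - (v a + v c) = v b + (∑ r ∈ Finset.univ \ {a, b, c}, v r) by linarith only [hV]] at h
    have hw := mul_le_mul_of_nonneg_right hd_disc (add_nonneg (add_nonneg (add_nonneg hAab hTa) hAbc) hTc)
    linarith only [h, hw, hba, hca, hcb]
  exact ⟨r_E, r_rec1_2, r_rec1_3, r_del1, r_rec2_1, r_rec2_3, r_del2, r_rec3_1, r_rec3_2, r_del3, r_recR_1, r_recR_2, r_recR_3, r_delR, r_rec12_3, r_del12, r_rec13_2, r_del13⟩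

end Summit.Ventures.Crystal3D.Theorems
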